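import Mathlib
import HarnessLib
import Summits.ValiantsHypothesis.ValiantsHypothesis.Theses.MonotoneRestoration
import Literature.Computability.AlgebraicComplexity.DiPatternExpressions
import Literature.Computability.AlgebraicComplexity.ValiantClasses
import Literature.Computability.AlgebraicComplexity.ValiantClassesProofs
import Literature.Computability.AlgebraicComplexity.QPBoundedClosure
import Summits.ValiantsHypothesis.ValiantsHypothesis.Theorems.MonotoneRestorationOrbitCompressionQPDiLine
import Summits.ValiantsHypothesis.ValiantsHypothesis.Theorems.MonotoneRestorationOrbitCompressionQPCruxHomogeneous

/-!
# Route MonotoneRestoration — aside `OrbitCompressionQP` (stmt-ValiantsHypothesis-18332): HOMOGENEOUS NORMAL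
# FORM OF ONE-SORTED COMPRESSION — the crux follows from DI-COMPRESSION OF HOMOGENEOUS FAMILIES alone

Helper file (`--supports stmt-ValiantsHypothesis-18332`), def-free.  After the refutation of the registered
first stub of line `expression_compression`, the one-sorted re-cut `OrbitSupport.OrbitCompressionQP_of_diStubs`
(`Theorems/…OrbitCompressionQPDiLine.lean`) reduces the crux to ONE open statement, DI-COMPRESSION (Stub 2′):
a matrix-symmetric `VP` family presented, for `n ≥ 1`, by closed ONE-SORTED labelled pattern expressions with
`n^k ≤ 2^((log₂ n + c)^c)` labels is so presented with length `≤ 2^((log₂ n + c)^c)` as well.  This file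
normalises that statement to HOMOGENEOUS families:

* `exists_value_eq_castLE_length`, `exists_diClose_eq_pad_length` — padding one-sorted expressions with idle
  labels, WITH LENGTH CONTROL (`|e'| = |e| + 2`); `exists_diClose_eq_sum_range` — a sum of `m + 1` closed
  one-sorted expressions with `≤ K` labels and length `≤ t` each is a closed expression with `K` labels and
  length `≤ (m + 1)(t + 3)`;
* ★ `diCompression_iff_homogeneous` — **Stub 2′ ⟺ Stub 2′ on HOMOGENEOUS families** (`f_n` homogeneous of some
  degree `d_n` for every `n`): the hypotheses pass to homogeneous components (matrix symmetry:
  `OrbitCompressionQPCruxHomogeneous.homogeneousComponent_rename`; `VP`: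
  `OrbitRestorationLinearVolumeQPHomogeneous.isVPFamily_homogeneousComponent`; narrow one-sorted presentations,
  label for label: `OrbitCompressionQPCruxHomogeneous.exists_diClose_eq_homogeneousComponent`), and the
  HARDEST-COMPONENT SELECTION on `μ(n,d)` = least `M` with a presentation of `f_n^{(d)}` having `n^k ≤ M` and
  length `≤ M` re-assembles `f_n = Σ_{d ≤ deg f_n} f_n^{(d)}` uniformly in `d`;
* ★ `orbitCompressionQP_of_homogeneous_diCompression` — hence **`OrbitCompressionQP` follows from di-compression
  of HOMOGENEOUS matrix-symmetric `VP` families alone** (composition with `OrbitCompressionQP_of_diStubs`).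

Honest label: a normal form of the single open statement of the one-sorted re-cut (VH-free bookkeeping);
`OrbitCompressionQP`, the route and VP ≠ VNP are NOT moved.  References: Dawar–Pago–Seppelt 2025 §5, §7;
Bürgisser–Clausen–Shokrollahi 1997, Lemma 21.25.
-/

noncomputable section

-- `Summit.ValiantsHypothesis.ValiantsHypothesis.…` is the tree's single-conjunct layout (Sub = Summit).
set_option linter.dupNamespace false

namespace Summit.ValiantsHypothesis.ValiantsHypothesis.Theorems.OrbitCompressionQPDiCompressionHomogeneous

open Literature.Computability.AlgebraicComplexity MvPolynomial
open Literature.Computability.AlgebraicComplexity.DiPatternExpr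
open Summit.ValiantsHypothesis.ValiantsHypothesis.Theorems

/-! ### Padding and sums with length control -/

/-- Transport along `Fin.castLE` preserves the length and computes the original value at the restricted
assignment. [folklore] -/
theorem exists_value_eq_castLE_length {k K : ℕ} (hk : k ≤ K) (n : ℕ) (e : DiPatternExpr ℂ k) :
    ∃ e' : DiPatternExpr ℂ K, e'.length = e.length ∧
      ∀ ℓ : Fin K → Fin n, e'.value n ℓ = e.value n (ℓ ∘ Fin.castLE hk) := by
  induction e with
  | edge a b => exact ⟨edge (Fin.castLE hk a) (Fin.castLE hk b), rfl, fun ℓ => by simp⟩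
  | const c => exact ⟨const c, rfl, fun ℓ => by simp⟩
  | add e₁ e₂ ih₁ ih₂ =>
    obtain ⟨e₁', hl₁, h₁⟩ := ih₁
    obtain ⟨e₂', hl₂, h₂⟩ := ih₂
    exact ⟨add e₁' e₂', by simp [DiPatternExpr.length, hl₁, hl₂], fun ℓ => by simp [h₁, h₂]⟩
  | mul e₁ e₂ ih₁ ih₂ =>
    obtain ⟨e₁', hl₁, h₁⟩ := ih₁
    obtain ⟨e₂', hl₂, h₂⟩ := ih₂
    exact ⟨mul e₁' e₂', by simp [DiPatternExpr.length, hl₁, hl₂], fun ℓ => by simp [h₁, h₂]⟩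
  | sumLabel a e ih =>
    obtain ⟨e', hl, h⟩ := ih
    refine ⟨sumLabel (Fin.castLE hk a) e', by simp [DiPatternExpr.length, hl], fun ℓ => ?_⟩
    simp only [value_sumLabel, h]
    refine Finset.sum_congr rfl fun v _ => ?_
    rw [Function.update_comp_eq_of_injective ℓ (Fin.castLE_injective hk) a v]

/-- **Padding with length control**: for `n ≥ 1` and `k ≤ K`, a closed one-sorted expression with `k`
labels is a closed one-sorted expression with `K` labels and length `|e| + 2`. [folklore] -/
theorem exists_diClose_eq_pad_length {k K : ℕ} (hk : k ≤ K) {n : ℕ} (hn : 1 ≤ n)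
    (e : DiPatternExpr ℂ k) :
    ∃ e' : DiPatternExpr ℂ K, e'.length = e.length + 2 ∧ e'.close n = e.close n := by
  obtain ⟨e', hl, he'⟩ := exists_value_eq_castLE_length hk n e
  refine ⟨mul (const (((n : ℂ) ^ (K - k))⁻¹)) e', by simp only [DiPatternExpr.length, hl]; omega, ?_⟩
  rw [OrbitSupport.diClose_constMul]
  unfold DiPatternExpr.close
  rw [Finset.sum_congr rfl fun ℓ _ => he' ℓ,
    OrbitSupport.sum_comp_castLE hk (fun h : Fin k → Fin n => e.value n h),
    nsmul_eq_mul, ← mul_assoc, ← map_natCast C, ← map_mul, Nat.cast_pow,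
    inv_mul_cancel₀ (pow_ne_zero _ (by exact_mod_cast (show n ≠ 0 by omega))), map_one, one_mul]

/-- **Sums with length control**: for `n ≥ 1`, if `g 0, …, g m` are closed one-sorted expressions with
`≤ K` labels and length `≤ t` each, then `Σ_{i ≤ m} g i` is a closed one-sorted expression with `K` labels
and length `≤ (m + 1)(t + 3)`. [folklore] -/
theorem exists_diClose_eq_sum_range {n K : ℕ} (hn : 1 ≤ n) (t : ℕ) :
    ∀ (m : ℕ) (g : ℕ → MvPolynomial (Fin n × Fin n) ℂ),
      (∀ i, i < m + 1 → ∃ (k : ℕ) (e : DiPatternExpr ℂ k), k ≤ K ∧ e.length ≤ t ∧ e.close n = g i) →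
      ∃ e : DiPatternExpr ℂ K, e.length ≤ (m + 1) * (t + 3) ∧
        e.close n = ∑ i ∈ Finset.range (m + 1), g i := by
  intro m
  induction m with
  | zero =>
    intro g hg
    obtain ⟨k, e, hk, hlen, he⟩ := hg 0 (Nat.succ_pos 0)
    obtain ⟨e', hl', he'⟩ := exists_diClose_eq_pad_length hk hn e
    exact ⟨e', by omega, by rw [he', he, Finset.sum_range_one]⟩
  | succ m ih =>
    intro g hg
    obtain ⟨e₁, hl₁, he₁⟩ := ih g fun i hi => hg i (by omega)
    obtain ⟨k, e, hk, hlen, he⟩ := hg (m + 1) (by omega)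
    obtain ⟨e₂, hl₂, he₂⟩ := exists_diClose_eq_pad_length hk hn e
    refine ⟨add e₁ e₂, ?_, ?_⟩
    · simp only [DiPatternExpr.length]
      calc e₁.length + e₂.length + 1 ≤ (m + 1) * (t + 3) + (t + 2) + 1 := by omega
        _ = (m + 1 + 1) * (t + 3) := by ring
    · rw [OrbitSupport.diClose_add, he₁, he₂, he, Finset.sum_range_succ _ (m + 1)]

/-! ### The normal form -/

/-- ★ **HOMOGENEOUS NORMAL FORM of di-compression (Stub 2′ of the one-sorted re-cut).**  The statement
(left, verbatim the hypothesis of `OrbitSupport.OrbitCompressionQP_of_diStubs`) holds if and only if it holds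
for HOMOGENEOUS families (right).  Backward direction: hardest-component selection, see the file header.
[cite: DawarPagoSeppelt2025, §5] -/
theorem diCompression_iff_homogeneous :
    (∀ f : (n : ℕ) → MvPolynomial (Fin n × Fin n) ℂ,
      (∀ (n : ℕ) (σ τ : Equiv.Perm (Fin n)),
        MvPolynomial.rename (fun p : Fin n × Fin n => (σ p.1, τ p.2)) (f n) = f n) →
      IsVPFamily f →
      (∃ c : ℕ, ∀ n : ℕ, 1 ≤ n → ∃ (k : ℕ) (e : DiPatternExpr ℂ k),
        n ^ k ≤ 2 ^ ((Nat.log 2 n + c) ^ c) ∧ e.close n = f n) →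
      ∃ c : ℕ, ∀ n : ℕ, 1 ≤ n → ∃ (k : ℕ) (e : DiPatternExpr ℂ k),
        n ^ k ≤ 2 ^ ((Nat.log 2 n + c) ^ c) ∧ e.length ≤ 2 ^ ((Nat.log 2 n + c) ^ c) ∧
        e.close n = f n) ↔
    (∀ f : (n : ℕ) → MvPolynomial (Fin n × Fin n) ℂ,
      (∃ d : ℕ → ℕ, ∀ n, (f n).IsHomogeneous (d n)) →
      (∀ (n : ℕ) (σ τ : Equiv.Perm (Fin n)),
        MvPolynomial.rename (fun p : Fin n × Fin n => (σ p.1, τ p.2)) (f n) = f n) →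
      IsVPFamily f →
      (∃ c : ℕ, ∀ n : ℕ, 1 ≤ n → ∃ (k : ℕ) (e : DiPatternExpr ℂ k),
        n ^ k ≤ 2 ^ ((Nat.log 2 n + c) ^ c) ∧ e.close n = f n) →
      ∃ c : ℕ, ∀ n : ℕ, 1 ≤ n → ∃ (k : ℕ) (e : DiPatternExpr ℂ k),
        n ^ k ≤ 2 ^ ((Nat.log 2 n + c) ^ c) ∧ e.length ≤ 2 ^ ((Nat.log 2 n + c) ^ c) ∧
        e.close n = f n) := by
  constructor
  · exact fun H f _ hsymm hVP hnarrow => H f hsymm hVP hnarrow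
  intro H f hsymm hVP hnarrow
  classical
  obtain ⟨c₀, hc₀⟩ := hnarrow
  -- the hypotheses pass to every family of homogeneous components
  have hnarrow_comp : ∀ d : ℕ → ℕ, ∃ c : ℕ, ∀ n : ℕ, 1 ≤ n → ∃ (k : ℕ) (e : DiPatternExpr ℂ k),
      n ^ k ≤ 2 ^ ((Nat.log 2 n + c) ^ c) ∧ e.close n = homogeneousComponent (d n) (f n) := by
    intro d
    refine ⟨c₀, fun n hn => ?_⟩
    obtain ⟨k, e, hk, he⟩ := hc₀ n hn
    obtain ⟨e', he'⟩ :=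
      OrbitCompressionQPCruxHomogeneous.exists_diClose_eq_homogeneousComponent (n := n) e (d n)
    exact ⟨k, e', hk, by rw [he', he]⟩
  have hsymm_comp : ∀ (d : ℕ → ℕ) (n : ℕ) (σ τ : Equiv.Perm (Fin n)),
      rename (fun p : Fin n × Fin n => (σ p.1, τ p.2)) (homogeneousComponent (d n) (f n)) =
        homogeneousComponent (d n) (f n) := by
    intro d n σ τ
    rw [← OrbitCompressionQPCruxHomogeneous.homogeneousComponent_rename, hsymm]
  have hVP_comp : ∀ d : ℕ → ℕ, IsVPFamily fun n => homogeneousComponent (d n) (f n) :=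
    OrbitRestorationLinearVolumeQPHomogeneous.isVPFamily_homogeneousComponent f hVP
  -- the measure `μ n d`
  have hex : ∀ n d : ℕ, ∃ M : ℕ, 1 ≤ n → ∃ (k : ℕ) (e : DiPatternExpr ℂ k),
      n ^ k ≤ M ∧ e.length ≤ M ∧ e.close n = homogeneousComponent d (f n) := by
    intro n d
    rcases Nat.eq_zero_or_pos n with hn | hn
    · exact ⟨0, fun h => absurd hn (by omega)⟩
    · obtain ⟨k, e, -, he⟩ := hc₀ n hn
      obtain ⟨e', he'⟩ :=
        OrbitCompressionQPCruxHomogeneous.exists_diClose_eq_homogeneousComponent (n := n) e d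
      exact ⟨max (n ^ k) e'.length, fun _ =>
        ⟨k, e', le_max_left _ _, le_max_right _ _, by rw [he', he]⟩⟩
  let μ : ℕ → ℕ → ℕ := fun n d => Nat.find (hex n d)
  have hμ_spec : ∀ n d : ℕ, 1 ≤ n → ∃ (k : ℕ) (e : DiPatternExpr ℂ k),
      n ^ k ≤ μ n d ∧ e.length ≤ μ n d ∧ e.close n = homogeneousComponent d (f n) :=
    fun n d => Nat.find_spec (hex n d)
  have hμ_min : ∀ (n d M : ℕ), (1 ≤ n → ∃ (k : ℕ) (e : DiPatternExpr ℂ k),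
      n ^ k ≤ M ∧ e.length ≤ M ∧ e.close n = homogeneousComponent d (f n)) → μ n d ≤ M :=
    fun n d M hM => Nat.find_min' (hex n d) hM
  -- the hardest component per level
  have hmax : ∀ n : ℕ, ∃ d : ℕ, ∀ d' : ℕ, d' ≤ (f n).totalDegree → μ n d' ≤ μ n d := by
    intro n
    obtain ⟨d, -, hd⟩ := Finset.exists_max_image (Finset.range ((f n).totalDegree + 1)) (μ n)
      ⟨0, Finset.mem_range.2 (Nat.succ_pos _)⟩
    exact ⟨d, fun d' hd' => hd d' (Finset.mem_range.2 (Nat.lt_succ_of_le hd'))⟩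
  choose dstar hdstar using hmax
  obtain ⟨c₁, hc₁⟩ := H (fun n => homogeneousComponent (dstar n) (f n))
    ⟨dstar, fun n => homogeneousComponent_isHomogeneous (dstar n) (f n)⟩
    (hsymm_comp dstar) (hVP_comp dstar) (hnarrow_comp dstar)
  have hμQ : ∀ n : ℕ, 1 ≤ n → ∀ d : ℕ, d ≤ (f n).totalDegree →
      μ n d ≤ 2 ^ ((Nat.log 2 n + c₁) ^ c₁) := by
    intro n hn d hd
    refine (hdstar n d hd).trans (hμ_min n (dstar n) _ fun _ => ?_)
    obtain ⟨k, e, hk, hlen, he⟩ := hc₁ n hn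
    exact ⟨k, e, hk, hlen, he⟩
  -- quasi-polynomial bookkeeping for the re-assembled length
  obtain ⟨c₂, hc₂⟩ : IsQPBounded fun n =>
      ((f n).totalDegree + 1) * (2 ^ ((Nat.log 2 n + c₁) ^ c₁) + 3) :=
    IsQPBounded.mul (IsPBounded.add_holds hVP.1.2 (IsPBounded.const 1)).isQPBounded
      (IsQPBounded.add ⟨c₁, fun n => le_rfl⟩ (IsQPBounded.const 3))
  refine ⟨max c₁ c₂, fun n hn => ?_⟩
  -- per level: label counts `k d` and expressions for all components, a common label budget `K`
  have hcomp : ∀ d : ℕ, ∃ (k : ℕ) (e : DiPatternExpr ℂ k), (d ≤ (f n).totalDegree →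
      n ^ k ≤ 2 ^ ((Nat.log 2 n + c₁) ^ c₁) ∧ e.length ≤ 2 ^ ((Nat.log 2 n + c₁) ^ c₁)) ∧
      e.close n = homogeneousComponent d (f n) := by
    intro d
    obtain ⟨k, e, h1, h2, h3⟩ := hμ_spec n d hn
    exact ⟨k, e, fun hd => ⟨h1.trans (hμQ n hn d hd), h2.trans (hμQ n hn d hd)⟩, h3⟩
  choose kd ed hked using hcomp
  obtain ⟨d₀, hd₀, hKmax⟩ := Finset.exists_max_image (Finset.range ((f n).totalDegree + 1)) kd
    ⟨0, Finset.mem_range.2 (Nat.succ_pos _)⟩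
  have hd₀' : d₀ ≤ (f n).totalDegree := Nat.le_of_lt_succ (Finset.mem_range.1 hd₀)
  obtain ⟨e, hlen, he⟩ := exists_diClose_eq_sum_range (K := kd d₀) hn
    (2 ^ ((Nat.log 2 n + c₁) ^ c₁)) (f n).totalDegree (fun d => homogeneousComponent d (f n))
    fun d hd => ⟨kd d, ed d, hKmax d (Finset.mem_range.2 hd),
      ((hked d).1 (by omega)).2, (hked d).2⟩
  refine ⟨kd d₀, e, ?_, ?_, ?_⟩
  · exact ((hked d₀).1 hd₀').1.trans
      (Nat.pow_le_pow_right Nat.two_pos (IsQPBounded.qexp_mono _ (le_max_left c₁ c₂)))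
  · exact (hlen.trans (hc₂ n)).trans
      (Nat.pow_le_pow_right Nat.two_pos (IsQPBounded.qexp_mono _ (le_max_right c₁ c₂)))
  · rw [he]
    exact sum_homogeneousComponent (f n)

/-- ★ **`OrbitCompressionQP` from di-compression of HOMOGENEOUS families alone** (normal form + the
one-sorted composition `OrbitSupport.OrbitCompressionQP_of_diStubs`, whose first stub is a theorem).
[cite: DawarPagoSeppelt2025, Theorem 1.1 and §7 (p. 45)] -/
theorem orbitCompressionQP_of_homogeneous_diCompression
    (H : ∀ f : (n : ℕ) → MvPolynomial (Fin n × Fin n) ℂ,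
      (∃ d : ℕ → ℕ, ∀ n, (f n).IsHomogeneous (d n)) →
      (∀ (n : ℕ) (σ τ : Equiv.Perm (Fin n)),
        MvPolynomial.rename (fun p : Fin n × Fin n => (σ p.1, τ p.2)) (f n) = f n) →
      IsVPFamily f →
      (∃ c : ℕ, ∀ n : ℕ, 1 ≤ n → ∃ (k : ℕ) (e : DiPatternExpr ℂ k),
        n ^ k ≤ 2 ^ ((Nat.log 2 n + c) ^ c) ∧ e.close n = f n) →
      ∃ c : ℕ, ∀ n : ℕ, 1 ≤ n → ∃ (k : ℕ) (e : DiPatternExpr ℂ k),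
        n ^ k ≤ 2 ^ ((Nat.log 2 n + c) ^ c) ∧ e.length ≤ 2 ^ ((Nat.log 2 n + c) ^ c) ∧
        e.close n = f n) :
    Summit.ValiantsHypothesis.ValiantsHypothesis.Theses.MonotoneRestoration.OrbitCompressionQP :=
  OrbitSupport.OrbitCompressionQP_of_diStubs (diCompression_iff_homogeneous.2 H)

end Summit.ValiantsHypothesis.ValiantsHypothesis.Theorems.OrbitCompressionQPDiCompressionHomogeneous

end
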